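import Mathlib
import HarnessLib
import Summits.ResolutionOfSingularities.ResolutionOfSingularities.Theorems.WildQuotientsWildQuotientResolutionJordanFourChartTTwistedModel
import Summits.ResolutionOfSingularities.ResolutionOfSingularities.Theorems.WildQuotientsWildQuotientResolutionJordanFourHalfChartRing
import Summits.ResolutionOfSingularities.ResolutionOfSingularities.Theorems.WildQuotientsWildQuotientResolutionJordanFourTwistedChartAction
import Summits.ResolutionOfSingularities.ResolutionOfSingularities.Theorems.WildQuotientsWildQuotientResolutionBlowupExitBasicOpenSections

/-!
# V4U brick `H₁` on the chart ring `(k[x][I₆t])_{(T′t·H′³t²)}`: everything but the seam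
(crux stmt-ResolutionOfSingularities-15640 `WildQuotients.WildQuotientResolution`, line `Sketch`;
chain w45c programme V4U, `L/w45c/CHAIN.md` v7.7 §4, brick `H₁` = the hypothesis of res-L1-w45c-lead-1's
`JordanFour.coneBrick_T_of_ringBrick` (p508076) / `jordanFour_hasResolution_of_ringBricks` (p512651);
res-L1-w45c-stub-1, support (c) of res-L1-w45c-plan-1's 07:13:11Z line, for the H₁ shadow
(res-L1-w45c-stub-2, RULING 08:37Z) / res-type-036's file 4. [OURS · L1 W4.5c] — NOT a statement of
any manuscript; replaces the role of no printed item. Prover res-L1-w45c-stub-1.)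

`JordanFour.exists_ringBrick_T_chartW`: for the `J₄` datum `σ` (characteristic `p ≥ 5`), ANY family
`φ : ⟨σ⟩ → (graded endomorphisms of R[I₆t])` with the affine-quotient coefficient law and the powers
condition `hP` at `s_W = T′t · H′³t²` (the outputs of res-L1-w45c-stub-5's seam
`JordanFour.exists_sectionsEquiv_chartW`, p514168), and ANY elements `t_j ∈ B_W = (k[x][I₆t])_{(s_W)}`
(`j ≠ 4`) with `T′/1 · t_j = g_j/1`: there are `R₀`, `J₀` (radical, regular affine blow-up) and an
injective `ψC : R₀ → B_W` with
**`Set.range ψC = {y | ∀ g, HomogeneousLocalization.map (φ g) y = y}`** (stated with `Set.range`: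
`RingHom.range` does not elaborate against the homogeneous localisation's instances) and
**`√(ψC⁻¹⟨x_a/1, x_b/1, x_c/1, t_j⟩) = J₀`**.
So the scheme brick `H₁` is this theorem read through the seam's `Ω : B_W ≃+* Γ(↥O₁, …)`
(`ψ := Ω ∘ ψC`, (i′) for the base elements, (iii) for the invariants).

Assembly: res-type-036's `JordanFour.exists_ringBrick_T_model` (p510790) at
`L := Localization.Away (twistedQ …)`, `τ_L :=` the localised translation `Σ_T` (built here,
`exists_translate_away`), `eE :=` stub-1's `exists_chartW_away_ringEquiv_evenModel` (p514513); the range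
conversion «`τ_L`-fixed ↔ fixed by every `map (φ g)`» by stub-5's degree-`m` E-engine
`BlowupExit.map_away_eq_of_intertwines_deg` (p510259; `s_W = (T′H′³)t³`, `T′H′³` is `⟨σ⟩`-invariant)
and stub-1's `exists_twistedChart_expo_algebraMap_and_fixed_iff` (p510734).
-/

-- single-problem summit: the doubled namespace component `ResolutionOfSingularities` is forced
set_option linter.dupNamespace false

noncomputable section

open MvPolynomial AlgebraicGeometry Polynomial HomogeneousLocalization Literature.AlgebraicGeometry.Resolution

namespace Summit.ResolutionOfSingularities.ResolutionOfSingularities.Theorems.WildQuotientResolution.JordanFour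

variable (k : Type) [Field k] (n : ℕ) (a b c d : Fin n)

/-- The eight generators of `I₆` (vector literal of record). -/
local notation3 "g8" => (![X a ^ 2, X a * X b ^ 2, X a * X b * X c, X a * X c ^ 3, X b ^ 3,
  X b ^ 2 * X c ^ 2, X b * X c ^ 4, X c ^ 6] : Fin 8 → MvPolynomial (Fin n) k)
/-- `I₆`. -/
local notation3 "I6" => Ideal.span (Set.range g8)
/-- The section `s_W = T′t · H′³t²` defining `chartW`. -/
local notation3 "sW" => (reesT (tPrime k n a b c d) (tPrime_mem_I6 k n a b c d) * hCubeT2 k n a b c)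
/-- The chart ring `B_W = (k[x][I₆t])_{(s_W)}`. -/
local notation3 "BW" => HomogeneousLocalization.Away (reesGrading I6) sW

/-! ## The translation `Σ_T` and its localisation at `Q` -/

/-- **A concrete translation `Σ_T`** (`ξ ↦ ξ + s`, all other variables fixed) exists as a `k`-algebra
endomorphism of `k[x]`. [folklore] -/
theorem exists_translate :
    ∃ τ : MvPolynomial (Fin n) k →ₐ[k] MvPolynomial (Fin n) k,
      τ (X c) = X c + X b ∧ ∀ i, i ≠ c → τ (X i) = X i := by
  classical
  refine ⟨MvPolynomial.aeval fun i => if i = c then X c + X b else X i, ?_, fun i hi => ?_⟩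
  · rw [MvPolynomial.aeval_X, if_pos rfl]
  · rw [MvPolynomial.aeval_X, if_neg hi]

/-- **Localising an endomorphism at a fixed element**: for a `k`-algebra endomorphism `τ` of `k[x]`
with `τ Q = Q`, there is a `k`-algebra endomorphism `τ_L` of `L = k[x][1/Q]` over `τ`. [folklore] -/
theorem exists_localize_algHom (Q : MvPolynomial (Fin n) k)
    (τ : MvPolynomial (Fin n) k →ₐ[k] MvPolynomial (Fin n) k) (hτQ : τ Q = Q)
    (L : Type) [CommRing L] [Algebra k L] [Algebra (MvPolynomial (Fin n) k) L]
    [IsScalarTower k (MvPolynomial (Fin n) k) L] [IsLocalization.Away Q L] :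
    ∃ τL : L →ₐ[k] L, ∀ r, τL (algebraMap (MvPolynomial (Fin n) k) L r) =
      algebraMap (MvPolynomial (Fin n) k) L (τ r) := by
  have hunit : IsUnit (((algebraMap (MvPolynomial (Fin n) k) L).comp τ.toRingHom) Q) := by
    rw [RingHom.comp_apply, AlgHom.toRingHom_eq_coe, RingHom.coe_coe, hτQ]
    exact IsLocalization.Away.algebraMap_isUnit Q
  let τ₀ : L →+* L := IsLocalization.Away.lift Q hunit
  have hτ₀ : ∀ r, τ₀ (algebraMap (MvPolynomial (Fin n) k) L r) =
      algebraMap (MvPolynomial (Fin n) k) L (τ r) := fun r => by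
    change IsLocalization.Away.lift Q hunit _ = _
    rw [IsLocalization.Away.lift_eq]
    rfl
  refine ⟨{ τ₀ with commutes' := fun r => ?_ }, hτ₀⟩
  change τ₀ (algebraMap k L r) = algebraMap k L r
  rw [IsScalarTower.algebraMap_apply k (MvPolynomial (Fin n) k) L, hτ₀, AlgHom.commutes]

/-! ## `⟨σ⟩`-invariance of `T′ H′³` -/

section Invariance

variable (σ : MvPolynomial (Fin n) k ≃ₐ[k] MvPolynomial (Fin n) k)
  (hab : a ≠ b) (hac : a ≠ c) (had : a ≠ d)
  (hσb : σ (X b) = X b + X a) (hσc : σ (X c) = X c + X b) (hσd : σ (X d) = X d + X c)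
  (hσ : ∀ i, i ≠ b → i ≠ c → i ≠ d → σ (X i) = X i)

include hab hac had hσb hσc hσd hσ in
/-- `T′ H′³` is fixed by every element of `⟨σ⟩` (the coefficient of `s_W = (T′H′³) t³`). [OURS · L1 W4.5c] -/
theorem toRingEquiv_zpowers_tPrime_mul_hPrime_cube (g : Subgroup.zpowers σ) :
    MulSemiringAction.toRingEquiv (Subgroup.zpowers σ) (MvPolynomial (Fin n) k) g
        (tPrime k n a b c d * hPrime k n a b c ^ 3) =
      tPrime k n a b c d * hPrime k n a b c ^ 3 := by
  have hT : σ (tPrime k n a b c d) = tPrime k n a b c d :=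
    map_tPrime k n a b c d hab hac had (σ : MvPolynomial (Fin n) k →ₐ[k] MvPolynomial (Fin n) k)
      hσb hσc hσd hσ
  have hH : σ (hPrime k n a b c) = hPrime k n a b c :=
    map_hPrime k n a b c d hab hac had (σ : MvPolynomial (Fin n) k →ₐ[k] MvPolynomial (Fin n) k)
      hσb hσc hσ
  have hfix : σ • (tPrime k n a b c d * hPrime k n a b c ^ 3 : MvPolynomial (Fin n) k) =
      tPrime k n a b c d * hPrime k n a b c ^ 3 := by
    change σ (tPrime k n a b c d * hPrime k n a b c ^ 3) = _
    rw [map_mul, map_pow, hT, hH]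
  obtain ⟨z, hz⟩ := Subgroup.mem_zpowers_iff.mp g.2
  rw [toRingEquiv_zpowers_apply]
  change (g : MvPolynomial (Fin n) k ≃ₐ[k] MvPolynomial (Fin n) k) •
      (tPrime k n a b c d * hPrime k n a b c ^ 3 : MvPolynomial (Fin n) k) = _
  rw [← hz]
  exact MulAction.fixedBy_subset_fixedBy_zpow (MvPolynomial (Fin n) k) σ z hfix

end Invariance

/-! ## The brick on `B_W` -/

/-- The underlying polynomial of `s_W`: `(T′H′³) t³`. [folklore] -/
theorem coe_sectionW :
    ((sW : reesAlgebra I6) : (MvPolynomial (Fin n) k)[X]) =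
      monomial 3 (tPrime k n a b c d * hPrime k n a b c ^ 3) := by
  rw [Subalgebra.coe_mul, coe_reesT, coe_hCubeT2, monomial_mul_monomial]

/-- `s_W` is homogeneous of degree `3`. [folklore] -/
theorem sectionW_mem : (sW : reesAlgebra I6) ∈ reesGrading I6 3 :=
  chartW_section_mem k n a b c d

-- the statement quantifies over the seam's data; elaboration needs head-room
set_option maxHeartbeats 1600000 in
/-- **The ring brick `H₁` on the chart ring `B_W`, modulo the seam** (see the module docstring).
[OURS · L1 W4.5c] [folklore; assembly of landed decls] -/
theorem exists_ringBrick_T_chartW (p : ℕ) (hp : p.Prime) (hp5 : 5 ≤ p) [CharP k p]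
    (σ : MvPolynomial (Fin n) k ≃ₐ[k] MvPolynomial (Fin n) k) [Finite ↥(Subgroup.zpowers σ)]
    (hab : a ≠ b) (hac : a ≠ c) (had : a ≠ d) (hbc : b ≠ c) (hbd : b ≠ d) (hcd : c ≠ d)
    (hσb : σ (X b) = X b + X a) (hσc : σ (X c) = X c + X b) (hσd : σ (X d) = X d + X c)
    (hσ : ∀ i, i ≠ b → i ≠ c → i ≠ d → σ (X i) = X i)
    (φ : ↥(Subgroup.zpowers σ) → (reesGrading I6 →+*ᵍ reesGrading I6))
    (hφ : ∀ (g : ↥(Subgroup.zpowers σ)) x, ((φ g x : reesAlgebra I6) : (MvPolynomial (Fin n) k)[X]) =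
      (x : (MvPolynomial (Fin n) k)[X]).map ((MulSemiringAction.toRingEquiv
        (↥(Subgroup.zpowers σ)) (MvPolynomial (Fin n) k) g⁻¹ : _ ≃+* _) : _ →+* _))
    (hP : ∀ g, Submonoid.powers sW ≤ (Submonoid.powers sW).comap (φ g))
    (t : {j : Fin 8 // j ≠ 4} → BW)
    (ht : ∀ j, ((fromZeroRingHom (reesGrading I6) (.powers sW)).comp (reesGrading.zeroRingHom I6)) (tPrime k n a b c d) * t j = ((fromZeroRingHom (reesGrading I6) (.powers sW)).comp (reesGrading.zeroRingHom I6)) (g8 j.1)) :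
    ∃ (R₀ : Type) (_ : CommRing R₀) (J₀ : Ideal R₀) (ψC : R₀ →+* BW),
      Function.Injective ψC ∧
      (∀ y : BW, y ∈ Set.range ψC ↔ ∀ g, HomogeneousLocalization.map (φ g) (hP g) y = y) ∧
      J₀.IsRadical ∧ Scheme.IsRegular (affineBlowup J₀) ∧
      ((Ideal.span (((fromZeroRingHom (reesGrading I6) (.powers sW)).comp (reesGrading.zeroRingHom I6)) '' {X a, X b, X c} ∪ Set.range t)).comap ψC).radical = J₀ := by
  classical
  have h2 : (2 : k) ≠ 0 := two_ne_zero_of_charP k p hp5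
  have h3 : (3 : k) ≠ 0 := three_ne_zero_of_charP k p hp5
  -- the translation and its localisation at `Q`
  obtain ⟨τ, hτc, hτ⟩ := exists_translate k n b c
  have hτQ : τ (twistedQ k n a b d) = twistedQ k n a b d :=
    translate_twistedQ k n a b c d τ hτ hac hbc hcd
  have hQne : twistedQ k n a b d ≠ 0 := fun h =>
    twistedQ_not_mem_span_X_abc k n a b c d (h ▸ Ideal.zero_mem _)
  let L : Type := Localization.Away (twistedQ k n a b d)
  haveI : IsDomain L :=
    IsLocalization.isDomain_localization (powers_le_nonZeroDivisors_of_noZeroDivisors hQne)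
  have hinjL : Function.Injective (algebraMap (MvPolynomial (Fin n) k) L) :=
    IsLocalization.injective L (powers_le_nonZeroDivisors_of_noZeroDivisors hQne)
  have hτL := exists_localize_algHom k n (twistedQ k n a b d) τ hτQ L
  obtain ⟨τL, hτL⟩ := hτL
  -- the chart model `B_W ≃ E ⊆ L` (stub-1 p514513)
  have hev := exists_chartW_away_ringEquiv_evenModel k n a b c d hab hac had hbc hbd hcd h2 h3 L
  obtain ⟨e, he1, he2, he3⟩ := hev
  -- the model brick (res-type-036 p510790)
  have hmodel := exists_ringBrick_T_model k n a b c d p hp hp5 hab hac had hbc hbd hcd τ hτc hτ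
    (L := L) τL hτL _ rfl (C := BW) ((fromZeroRingHom (reesGrading I6) (.powers sW)).comp (reesGrading.zeroRingHom I6)) e (fun F => he1 F) t ht
  obtain ⟨R₀, _, J₀, ψC, hinj, hrangeτ, hrad, hreg, hJ⟩ := hmodel
  -- the exponent function of `⟨σ⟩` on the twisted chart (stub-1 p510734)
  have hexpo := exists_twistedChart_expo_algebraMap_and_fixed_iff k n a b c d hab hac had hbc hbd hcd
    τ hτc hτ σ hσb hσc hσd hσ h2 h3 (S := L) τL hτL
  obtain ⟨m, -, hmg, hfix⟩ := hexpo
  -- the model as a ring map `e' : B_W → L`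
  let e' : BW →+* L :=
    (Algebra.adjoin k (algebraMap (MvPolynomial (Fin n) k) L '' evenGens k n a b c ∪
      {IsLocalization.Away.invSelf (S := L) (twistedQ k n a b d)})).val.toRingHom.comp e.toRingHom
  have he' : ∀ y, e' y = ((e y : Algebra.adjoin k (algebraMap (MvPolynomial (Fin n) k) L ''
      evenGens k n a b c ∪ {IsLocalization.Away.invSelf (S := L) (twistedQ k n a b d)})) : L) :=
    fun y => rfl
  have he'inj : Function.Injective e' := Subtype.val_injective.comp e.injective
  have he'base : ∀ F, e' (((fromZeroRingHom (reesGrading I6) (.powers sW)).comp (reesGrading.zeroRingHom I6)) F) = algebraMap (MvPolynomial (Fin n) k) L (twistedChart k n a b c d F) :=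
    fun F => he1 F
  -- the E-engine in degree `3` for every `g`
  have hnzd : e' (((fromZeroRingHom (reesGrading I6) (.powers sW)).comp (reesGrading.zeroRingHom I6)) (tPrime k n a b c d * hPrime k n a b c ^ 3)) ∈ nonZeroDivisors L := by
    apply mem_nonZeroDivisors_of_ne_zero
    rw [he'base, map_ne_zero_iff _ hinjL, map_mul, map_pow,
      twistedChart_tPrime k n a b c d hab hac had hbc hbd hcd h2 h3,
      twistedChart_hPrime k n a b c d hab hac hbc h2]
    exact mul_ne_zero (mul_ne_zero (pow_ne_zero 6 (X_ne_zero b)) hQne)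
      (pow_ne_zero 3 (mul_ne_zero (pow_ne_zero 4 (X_ne_zero b)) hQne))
  have hengine : ∀ (g : ↥(Subgroup.zpowers σ)) (y : BW),
      e' (HomogeneousLocalization.map (φ g) (hP g) y) = (τL ^ m g⁻¹) (e' y) := by
    intro g y
    have h := BlowupExit.map_away_eq_of_intertwines_deg sW (sectionW_mem k n a b c d)
      (tPrime k n a b c d * hPrime k n a b c ^ 3) (coe_sectionW k n a b c d) (φ g)
      ((MulSemiringAction.toRingEquiv (↥(Subgroup.zpowers σ)) (MvPolynomial (Fin n) k) g⁻¹ :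
        _ ≃+* _) : _ →+* _) (hφ g)
      (toRingEquiv_zpowers_tPrime_mul_hPrime_cube k n a b c d σ hab hac had hσb hσc hσd hσ g⁻¹)
      (hP g) e' hnzd (τL ^ m g⁻¹).toRingHom (fun r => ?_) y
    · exact h
    · change (τL ^ m g⁻¹) (e' (((fromZeroRingHom (reesGrading I6) (.powers sW)).comp (reesGrading.zeroRingHom I6)) r)) = e' (((fromZeroRingHom (reesGrading I6) (.powers sW)).comp (reesGrading.zeroRingHom I6)) _)
      rw [he'base, he'base, hmg]
      rfl
  -- the range conversion
  have hconv : ∀ y : BW, (∀ g, HomogeneousLocalization.map (φ g) (hP g) y = y) ↔ τL (e' y) = e' y := by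
    intro y
    rw [← hfix (e' y)]
    constructor
    · intro h g
      have h1 := hengine g⁻¹ y
      rw [inv_inv, h g⁻¹] at h1
      exact h1.symm
    · intro h g
      apply he'inj
      rw [hengine, h g⁻¹]
  refine ⟨R₀, inferInstance, J₀, ψC, hinj, fun y => ?_, hrad, hreg, hJ⟩
  have hy := hrangeτ y
  rw [RingHom.mem_range] at hy
  rw [Set.mem_range, hy, ← he', hconv]

end Summit.ResolutionOfSingularities.ResolutionOfSingularities.Theorems.WildQuotientResolution.JordanFour

end
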